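import Mathlib.NumberTheory.Padics.PadicVal.Basic
import Mathlib.Data.Nat.Choose.Multinomial
import Mathlib.Data.Nat.Digits.Lemmas
import Mathlib.Data.ZMod.Basic
import HarnessLib

/-!
# Digit-sum arithmetic for the Ax–Katz theorem (Wan's congruence proof)

Topic `Literature/FieldTheory/QuasiAlgClosed`. This file is the purely arithmetical core of
D. Wan's "Chevalley–Warning" proof of the theorems of Ax (1964) and Katz (1971)
[Wan1995, §§2–3]: a lower bound for the `p`-adic valuation of the multinomial coefficients that
appear when `F̃(x)^{(q-1)q^m}` (`F̃` a lift of a polynomial of degree `≤ d` over `𝔽_q`,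
`q = p^f`) is expanded and summed over the Teichmüller points.

Everything here is about natural numbers only; the Witt-vector part of the argument and the
theorem of Ax itself are in `Literature/FieldTheory/QuasiAlgClosed/AxKatzProofs.lean`.

## Main result

* `AxKatz.pow_dvd_multinomial` — let `λ : α → ℕ` on a finite set `s` have total mass
  `∑ λ = (p^f - 1) p^{fm}`, let `e j : ι → ℕ` (`j ∈ s`) be exponent vectors of weight `≤ d`, and
  suppose every coordinate `uᵢ = ∑ⱼ λⱼ eⱼ(i)` is divisible by `p^f - 1`. If `s'` of the `uᵢ` are
  nonzero, then `p^{f (⌈s'/d⌉ - 1)}` divides the multinomial coefficient `(∑ λ)! / ∏ λⱼ!`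
  [Wan1995, (3.5)–(3.13) with `r = 1`, `j₁ = q - 1`].

## Ingredients (all [folklore])

* Legendre's formula in digit form (Mathlib `sub_one_mul_padicValNat_factorial`), giving
  `(p-1)·v_p(multinomial) + s_p(∑ λ) = ∑ s_p(λⱼ)` (`sub_one_mul_padicValNat_multinomial_add`);
* the explicit base-`p` digits `n / p^i % p` (`sum_div_pow_mod_mul_pow`, `…_eq_digits_sum`);
* the digit ROTATION `r_a(n) = ∑ᵢ cᵢ p^{(i+a) mod f}`: `r_a(n) ≡ p^a n (mod p^f - 1)`,
  `r_a(n) = 0 ↔ n = 0`, and the "simple fact" `(p-1) ∑_{a<f} r_a(n) = (p^f-1) s_p(n)`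
  [Wan1995, p. 50] (`natCast_rot`, `rot_eq_zero_iff`, `sub_one_mul_sum_rot`);
* `s_p((p^f-1)p^{fm}) = f (p-1)` (`digits_sum_pow_sub_one_mul_pow`).

No new definitions are introduced (the rotation is written out as an explicit sum).

## References

* D. Wan, *A Chevalley–Warning approach to p-adic estimates of character sums*,
  Proc. Amer. Math. Soc. 123 (1995) 45–54 [Wan1995].
* J. Ax, *Zeroes of polynomials over finite fields*, Amer. J. Math. 86 (1964) 255–261 [Ax1964].
-/

open Finset
open scoped BigOperators

namespace Literature.FieldTheory.QuasiAlgClosed.AxKatz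

variable {p : ℕ}

/-- Base-`p` expansion with the explicit digits `n / p ^ i % p`: for `n < p ^ B`,
`∑_{i<B} (n / p^i % p) p^i = n`. [folklore] -/
theorem sum_div_pow_mod_mul_pow (hp : 1 < p) :
    ∀ B n : ℕ, n < p ^ B → ∑ i ∈ range B, n / p ^ i % p * p ^ i = n := by
  intro B
  induction B with
  | zero =>
    intro n hn
    simp only [pow_zero, Nat.lt_one_iff] at hn
    subst hn
    simp
  | succ B ih =>
    intro n hn
    have hdiv : n / p < p ^ B := by
      rw [Nat.div_lt_iff_lt_mul (by omega)]
      simpa [pow_succ] using hn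
    rw [sum_range_succ']
    have h1 : ∀ i ∈ range B,
        n / p ^ (i + 1) % p * p ^ (i + 1) = p * (n / p / p ^ i % p * p ^ i) := by
      intro i _
      rw [pow_succ', ← Nat.div_div_eq_div_mul]
      ring
    rw [sum_congr rfl h1, ← mul_sum, ih (n / p) hdiv]
    simp only [pow_zero, Nat.div_one, mul_one]
    exact Nat.div_add_mod n p

/-- The explicit digits `n / p ^ i % p`, `i < B`, sum to the base-`p` digit sum of `n`
when `n < p ^ B`. [folklore] -/
theorem sum_div_pow_mod_eq_digits_sum (hp : 1 < p) :
    ∀ B n : ℕ, n < p ^ B → ∑ i ∈ range B, n / p ^ i % p = (p.digits n).sum := by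
  intro B
  induction B with
  | zero =>
    intro n hn
    simp only [pow_zero, Nat.lt_one_iff] at hn
    subst hn
    simp
  | succ B ih =>
    intro n hn
    rcases Nat.eq_zero_or_pos n with rfl | hn0
    · simp
    have hdiv : n / p < p ^ B := by
      rw [Nat.div_lt_iff_lt_mul (by omega)]
      simpa [pow_succ] using hn
    rw [sum_range_succ', Nat.digits_def' hp hn0, List.sum_cons]
    have h1 : ∀ i ∈ range B, n / p ^ (i + 1) % p = n / p / p ^ i % p := by
      intro i _
      rw [pow_succ', ← Nat.div_div_eq_div_mul]
    rw [sum_congr rfl h1, ih (n / p) hdiv]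
    simp only [pow_zero, Nat.div_one]
    ring

/-- The geometric sum `∑_{a<f} p^a` is invariant under rotating the exponents modulo `f`:
`∑_{a<f} p^{(i+a) mod f} = ∑_{a<f} p^a`. [folklore] -/
theorem sum_pow_mod_rotate {f : ℕ} (hf : 0 < f) (i : ℕ) :
    ∑ a ∈ range f, p ^ ((i + a) % f) = ∑ a ∈ range f, p ^ a := by
  haveI : NeZero f := ⟨hf.ne'⟩
  rw [Finset.sum_range (fun a => p ^ ((i + a) % f)), Finset.sum_range (fun a => p ^ a)]
  set iF : Fin f := ⟨i % f, Nat.mod_lt _ hf⟩ with hiF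
  have h1 : ∀ a : Fin f, p ^ ((i + (a : ℕ)) % f) = p ^ ((iF + a : Fin f) : ℕ) := by
    intro a
    congr 1
    rw [Fin.val_add, hiF]
    simp [Nat.mod_add_mod]
  simp_rw [h1]
  exact Equiv.sum_comp (Equiv.addLeft iF) (fun b : Fin f => p ^ (b : ℕ))

/-- `(p - 1) ∑_{a<f} p^a = p^f - 1`. [folklore] -/
theorem sub_one_mul_sum_pow (f : ℕ) : (p - 1) * ∑ a ∈ range f, p ^ a = p ^ f - 1 := by
  rcases Nat.eq_zero_or_pos p with rfl | hp0
  · cases f <;> simp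
  have h := geom_sum_mul_add (p - 1) f
  have hp1 : p - 1 + 1 = p := by omega
  rw [hp1] at h
  -- h : (∑ a ∈ range f, p ^ a) * (p - 1) + 1 = p ^ f
  have h1 : 1 ≤ p ^ f := Nat.one_le_pow _ _ hp0
  rw [mul_comm]
  omega

/-- The digit rotation is congruent to multiplication by a power of `p`:
`∑_{i<B} cᵢ p^{(i+a) mod f} ≡ p^a · n (mod p^f - 1)` where `cᵢ = n / p^i % p` and `n < p^B`.
[cite: Wan1995, §3 p. 50 (the device behind (3.12))] -/
theorem natCast_rot (hp : 1 < p) (f a B n : ℕ) (hn : n < p ^ B) :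
    ((∑ i ∈ range B, n / p ^ i % p * p ^ ((i + a) % f) : ℕ) : ZMod (p ^ f - 1)) =
      ((p ^ a * n : ℕ) : ZMod (p ^ f - 1)) := by
  have hpf : ((p : ZMod (p ^ f - 1)) ^ f) = 1 := by
    have h1 : 1 ≤ p ^ f := Nat.one_le_pow _ _ (by omega)
    have h0 : ((p ^ f - 1 : ℕ) : ZMod (p ^ f - 1)) = 0 :=
      (ZMod.natCast_eq_zero_iff (p ^ f - 1) (p ^ f - 1)).mpr dvd_rfl
    have h2 : ((p ^ f - 1 + 1 : ℕ) : ZMod (p ^ f - 1)) = 1 := by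
      rw [Nat.cast_add, h0, Nat.cast_one, zero_add]
    rw [Nat.sub_add_cancel h1] at h2
    exact_mod_cast h2
  have hrot : ∀ i : ℕ, (p : ZMod (p ^ f - 1)) ^ ((i + a) % f) = (p : ZMod (p ^ f - 1)) ^ (i + a) := by
    intro i
    conv_rhs => rw [← Nat.div_add_mod (i + a) f, pow_add, pow_mul, hpf, one_pow, one_mul]
  conv_rhs => rw [← sum_div_pow_mod_mul_pow hp B n hn, mul_sum]
  push_cast
  refine sum_congr rfl fun i _ => ?_
  rw [hrot, pow_add]
  ring

/-- The digit rotation of `n < p^B` vanishes iff `n = 0`. [folklore] -/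
theorem rot_eq_zero_iff (hp : 1 < p) (f a B n : ℕ) (hn : n < p ^ B) :
    ∑ i ∈ range B, n / p ^ i % p * p ^ ((i + a) % f) = 0 ↔ n = 0 := by
  constructor
  · intro h
    rw [← sum_div_pow_mod_mul_pow hp B n hn]
    refine sum_eq_zero fun i hi => ?_
    have h2 := (sum_eq_zero_iff.mp h) i hi
    have hp0 : p ^ ((i + a) % f) ≠ 0 := pow_ne_zero _ (by omega)
    rcases mul_eq_zero.mp h2 with h3 | h3
    · rw [h3, zero_mul]
    · exact absurd h3 hp0
  · rintro rfl
    simp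

/-- Wan's "simple fact" [cite: Wan1995, p. 50, display after (3.13)]: summing the `f` digit
rotations recovers the digit sum, `(p-1) ∑_{a<f} r_a(n) = (p^f - 1) ∑_{i<B} cᵢ`. -/
theorem sub_one_mul_sum_rot {f : ℕ} (hf : 0 < f) (B n : ℕ) :
    (p - 1) * ∑ a ∈ range f, ∑ i ∈ range B, n / p ^ i % p * p ^ ((i + a) % f) =
      (p ^ f - 1) * ∑ i ∈ range B, n / p ^ i % p := by
  rw [sum_comm]
  have h1 : ∀ i ∈ range B, ∑ a ∈ range f, n / p ^ i % p * p ^ ((i + a) % f) =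
      n / p ^ i % p * ∑ a ∈ range f, p ^ a := by
    intro i _
    rw [← mul_sum, sum_pow_mod_rotate hf i]
  rw [sum_congr rfl h1, ← sum_mul, mul_comm (p - 1), mul_assoc, mul_comm _ (p - 1),
    sub_one_mul_sum_pow, mul_comm]

/-- `s_p(p^f - 1) = f (p - 1)`: the number `p^f - 1` has `f` digits `p - 1`. [folklore] -/
theorem digits_sum_pow_sub_one (hp : 1 < p) (f : ℕ) : (p.digits (p ^ f - 1)).sum = f * (p - 1) := by
  induction f with
  | zero => simp
  | succ f ih =>
    have h1 : 1 ≤ p ^ f := Nat.one_le_pow _ _ (by omega)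
    have h2 : 1 ≤ p ^ f * p := Nat.one_le_iff_ne_zero.mpr (by positivity)
    have h3 : p ^ (f + 1) - 1 = (p - 1) + p * (p ^ f - 1) := by
      rw [pow_succ]
      zify [h1, h2, (le_of_lt hp : 1 ≤ p)]
      ring
    rw [h3, Nat.digits_add p hp (p - 1) (p ^ f - 1) (Nat.sub_lt (by omega) one_pos)
      (Or.inl (by omega)), List.sum_cons, ih]
    ring

/-- `s_p((p^f - 1) p^{fm}) = f (p - 1)` for `f > 0`. [folklore] -/
theorem digits_sum_pow_sub_one_mul_pow (hp : 1 < p) {f : ℕ} (hf : 0 < f) (m : ℕ) :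
    (p.digits ((p ^ f - 1) * p ^ (f * m))).sum = f * (p - 1) := by
  have hq : 0 < p ^ f - 1 := by
    have := Nat.one_lt_pow hf.ne' hp
    omega
  rw [mul_comm, Nat.digits_base_pow_mul hp hq, List.sum_append, List.sum_replicate, smul_zero,
    zero_add, digits_sum_pow_sub_one hp f]

/-- The `p`-adic valuation of a finite product of nonzero naturals is the sum of the
valuations. [folklore] -/
theorem padicValNat_finset_prod [hp : Fact p.Prime] {α : Type*} (s : Finset α) (g : α → ℕ)
    (hg : ∀ j ∈ s, g j ≠ 0) : padicValNat p (∏ j ∈ s, g j) = ∑ j ∈ s, padicValNat p (g j) := by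
  classical
  induction s using Finset.induction_on with
  | empty => simp
  | insert a s ha ih =>
    rw [prod_insert ha, sum_insert ha,
      padicValNat.mul (hg a (mem_insert_self a s))
        (prod_ne_zero_iff.mpr fun j hj => hg j (mem_insert_of_mem hj)),
      ih fun j hj => hg j (mem_insert_of_mem hj)]

/-- Legendre's formula for multinomial coefficients, digit form:
`(p - 1) · v_p((∑ λ)! / ∏ λⱼ!) + s_p(∑ λ) = ∑ⱼ s_p(λⱼ)`. [cite: Wan1995, (3.5)] -/
theorem sub_one_mul_padicValNat_multinomial_add [hp : Fact p.Prime] {α : Type*} (s : Finset α)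
    (l : α → ℕ) :
    (p - 1) * padicValNat p (Nat.multinomial s l) + (p.digits (∑ j ∈ s, l j)).sum =
      ∑ j ∈ s, (p.digits (l j)).sum := by
  have hspec := Nat.multinomial_spec s l
  have hv : (∑ j ∈ s, padicValNat p (l j).factorial) + padicValNat p (Nat.multinomial s l) =
      padicValNat p (∑ j ∈ s, l j).factorial := by
    rw [← hspec, padicValNat.mul (prod_ne_zero_iff.mpr fun j _ => Nat.factorial_ne_zero _)
      (Nat.multinomial_pos s l).ne', padicValNat_finset_prod s _ fun j _ => Nat.factorial_ne_zero _]
  have hv' : (∑ j ∈ s, (l j - (p.digits (l j)).sum)) + (p - 1) * padicValNat p (Nat.multinomial s l)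
      = (∑ j ∈ s, l j) - (p.digits (∑ j ∈ s, l j)).sum := by
    have := congrArg (fun x => (p - 1) * x) hv
    simp only [mul_add, mul_sum, sub_one_mul_padicValNat_factorial] at this
    exact this
  have h1 : ∑ j ∈ s, (l j - (p.digits (l j)).sum) = ∑ j ∈ s, l j - ∑ j ∈ s, (p.digits (l j)).sum :=
    sum_tsub_distrib s fun j _ => Nat.digit_sum_le p (l j)
  have h2 : ∑ j ∈ s, (p.digits (l j)).sum ≤ ∑ j ∈ s, l j :=
    sum_le_sum fun j _ => Nat.digit_sum_le p (l j)
  have h3 := Nat.digit_sum_le p (∑ j ∈ s, l j)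
  rw [h1] at hv'
  omega

/-- **Key valuation estimate** of Wan's proof of the Ax–Katz theorem, case of one polynomial
[cite: Wan1995, Thm 3.1 proof, (3.5)–(3.13) with `r = 1`, `j₁ = q - 1`].
Let `q = p^f` (`f > 0`), `λ : α → ℕ` with `∑_{j∈s} λⱼ = (q-1) q^m`, exponent vectors
`eⱼ : ι → ℕ` of weight `≤ d` (`d > 0`), and suppose `q - 1 ∣ uᵢ := ∑ⱼ λⱼ eⱼ(i)` for every `i`.
If `s'` coordinates `uᵢ` are nonzero then `p^{f(⌈s'/d⌉ - 1)}` divides the multinomial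
coefficient `(∑ λ)!/∏ λⱼ!` (here `⌈s'/d⌉ = (s' + d - 1)/d`). -/
theorem pow_dvd_multinomial [hp : Fact p.Prime] {f m d : ℕ} (hf : 0 < f) (hd : 0 < d)
    {ι α : Type*} [Fintype ι] (s : Finset α) (e : α → ι → ℕ)
    (he : ∀ j ∈ s, ∑ i, e j i ≤ d) (l : α → ℕ)
    (hl : ∑ j ∈ s, l j = (p ^ f - 1) * p ^ (f * m))
    (hdiv : ∀ i, p ^ f - 1 ∣ ∑ j ∈ s, l j * e j i) :
    p ^ (f * (((Finset.univ.filter fun i => ∑ j ∈ s, l j * e j i ≠ 0).card + d - 1) / d - 1)) ∣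
      Nat.multinomial s l := by
  classical
  have hp1 : 1 < p := hp.out.one_lt
  set q' := p ^ f - 1 with hq'
  have hq'pos : 0 < q' := by
    have := Nat.one_lt_pow hf.ne' hp1
    omega
  set B := f * (m + 1) with hB
  have hlB : ∀ j ∈ s, l j < p ^ B := by
    intro j hj
    calc l j ≤ ∑ j ∈ s, l j := single_le_sum (fun _ _ => Nat.zero_le _) hj
      _ = q' * p ^ (f * m) := hl
      _ < p ^ f * p ^ (f * m) :=
          Nat.mul_lt_mul_of_pos_right (Nat.sub_lt (by positivity) one_pos) (by positivity)
      _ = p ^ B := by rw [← pow_add, hB]; ring_nf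
  set S := (Finset.univ.filter fun i => ∑ j ∈ s, l j * e j i ≠ 0) with hS
  set C := (S.card + d - 1) / d with hC
  -- the rotations `r a j = ∑_{i<B} (l j / p^i % p) p^{(i+a) % f}`
  -- Step 1: for every `a`, `q' * C ≤ ∑ j ∈ s, r a j`.
  have step1 : ∀ a : ℕ, q' * C ≤ ∑ j ∈ s, ∑ i ∈ range B, l j / p ^ i % p * p ^ ((i + a) % f) := by
    intro a
    have hA : q' ∣ ∑ j ∈ s, ∑ i ∈ range B, l j / p ^ i % p * p ^ ((i + a) % f) := by
      rw [← ZMod.natCast_eq_zero_iff, Nat.cast_sum,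
        sum_congr rfl fun j hj => natCast_rot hp1 f a B (l j) (hlB j hj), ← Nat.cast_sum,
        ← mul_sum, hl, ZMod.natCast_eq_zero_iff]
      exact Dvd.dvd.mul_left (dvd_mul_right q' _) _
    have hU : ∀ i, q' ∣ ∑ j ∈ s, (∑ i ∈ range B, l j / p ^ i % p * p ^ ((i + a) % f)) * e j i := by
      intro i
      rw [← ZMod.natCast_eq_zero_iff, Nat.cast_sum]
      have h1 : ∀ j ∈ s, (((∑ i ∈ range B, l j / p ^ i % p * p ^ ((i + a) % f)) * e j i : ℕ) :
          ZMod q') = ((p ^ a * (l j * e j i) : ℕ) : ZMod q') := by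
        intro j hj
        rw [Nat.cast_mul, natCast_rot hp1 f a B (l j) (hlB j hj)]
        push_cast
        ring
      rw [sum_congr rfl h1, ← Nat.cast_sum, ← mul_sum, ZMod.natCast_eq_zero_iff]
      exact Dvd.dvd.mul_left (hdiv i) _
    have hUpos : ∀ i ∈ S,
        q' ≤ ∑ j ∈ s, (∑ i ∈ range B, l j / p ^ i % p * p ^ ((i + a) % f)) * e j i := by
      intro i hi
      apply Nat.le_of_dvd _ (hU i)
      have hne : ∑ j ∈ s, l j * e j i ≠ 0 := by simpa [hS] using hi
      obtain ⟨j, hj, hne'⟩ : ∃ j ∈ s, l j * e j i ≠ 0 := by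
        by_contra hcon
        push Not at hcon
        exact hne (sum_eq_zero hcon)
      apply Nat.pos_of_ne_zero
      intro hzero
      have h3 := (sum_eq_zero_iff.mp hzero) j hj
      rcases mul_eq_zero.mp h3 with h4 | h4
      · exact (mul_ne_zero_iff.mp hne').1 ((rot_eq_zero_iff hp1 f a B (l j) (hlB j hj)).mp h4)
      · exact (mul_ne_zero_iff.mp hne').2 h4
    have hsumU : ∑ i, ∑ j ∈ s, (∑ i ∈ range B, l j / p ^ i % p * p ^ ((i + a) % f)) * e j i ≤
        d * ∑ j ∈ s, ∑ i ∈ range B, l j / p ^ i % p * p ^ ((i + a) % f) := by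
      rw [sum_comm, mul_sum]
      refine sum_le_sum fun j hj => ?_
      rw [← mul_sum, mul_comm d]
      exact Nat.mul_le_mul_left _ (he j hj)
    have hSq : S.card * q' ≤ d * ∑ j ∈ s, ∑ i ∈ range B, l j / p ^ i % p * p ^ ((i + a) % f) := by
      calc S.card * q' = ∑ i ∈ S, q' := by simp [sum_const]
        _ ≤ ∑ i ∈ S, ∑ j ∈ s, (∑ i ∈ range B, l j / p ^ i % p * p ^ ((i + a) % f)) * e j i :=
            sum_le_sum hUpos
        _ ≤ ∑ i, ∑ j ∈ s, (∑ i ∈ range B, l j / p ^ i % p * p ^ ((i + a) % f)) * e j i :=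
            sum_le_sum_of_subset_of_nonneg (filter_subset _ _) fun _ _ _ => Nat.zero_le _
        _ ≤ _ := hsumU
    obtain ⟨M, hM⟩ := hA
    rw [hM] at hSq ⊢
    have hSd : S.card ≤ d * M := by
      have h5 : S.card * q' ≤ (d * M) * q' := by
        calc S.card * q' ≤ d * (q' * M) := hSq
          _ = (d * M) * q' := by ring
      exact Nat.le_of_mul_le_mul_right h5 hq'pos
    have hCM : C ≤ M := by
      rw [hC]
      have h6 : (M + 1) * d = d * M + d := by ring
      have h7 : S.card + d - 1 < (M + 1) * d := by
        rw [h6]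
        omega
      exact Nat.lt_add_one_iff.mp ((Nat.div_lt_iff_lt_mul hd).mpr h7)
    exact Nat.mul_le_mul_left q' hCM
  -- Step 2: sum over the `f` rotations and use Wan's "simple fact".
  have step2 : q' * ((p - 1) * (f * C)) ≤ q' * ∑ j ∈ s, (p.digits (l j)).sum := by
    calc q' * ((p - 1) * (f * C)) = (p - 1) * ∑ a ∈ range f, q' * C := by
          simp [sum_const, card_range]; ring
      _ ≤ (p - 1) * ∑ a ∈ range f, ∑ j ∈ s, ∑ i ∈ range B, l j / p ^ i % p * p ^ ((i + a) % f) :=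
          Nat.mul_le_mul_left _ (sum_le_sum fun a _ => step1 a)
      _ = ∑ j ∈ s, (p - 1) * ∑ a ∈ range f, ∑ i ∈ range B, l j / p ^ i % p * p ^ ((i + a) % f) := by
          rw [sum_comm, mul_sum]
      _ = ∑ j ∈ s, q' * (p.digits (l j)).sum := by
          refine sum_congr rfl fun j hj => ?_
          rw [sub_one_mul_sum_rot hf B (l j), sum_div_pow_mod_eq_digits_sum hp1 B (l j) (hlB j hj)]
      _ = q' * ∑ j ∈ s, (p.digits (l j)).sum := by rw [mul_sum]
  have step3 : (p - 1) * (f * C) ≤ ∑ j ∈ s, (p.digits (l j)).sum :=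
    Nat.le_of_mul_le_mul_left step2 hq'pos
  -- Step 3: Legendre's formula.
  have hleg := sub_one_mul_padicValNat_multinomial_add (p := p) s l
  rw [hl, digits_sum_pow_sub_one_mul_pow hp1 hf m] at hleg
  have hv : f * C ≤ padicValNat p (Nat.multinomial s l) + f := by
    have h1 : (p - 1) * (f * C) ≤ (p - 1) * (padicValNat p (Nat.multinomial s l) + f) := by
      calc (p - 1) * (f * C) ≤ ∑ j ∈ s, (p.digits (l j)).sum := step3
        _ = (p - 1) * (padicValNat p (Nat.multinomial s l) + f) := by rw [← hleg]; ring
    exact Nat.le_of_mul_le_mul_left h1 (by omega)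
  rw [padicValNat_dvd_iff_le (Nat.multinomial_pos s l).ne', Nat.mul_sub_one]
  omega

end Literature.FieldTheory.QuasiAlgClosed.AxKatz
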